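/-
Origin: expansion seat `planner-pub-hodgecm-pv01-g5-0`, handover #1 2026-08-18T07:20:05Z (`HOME/pub-hodgecm-pv01-g5/lean/Pv01g5/EndStateThm44.lean`, md5 9274c4df, 237 lines);
landed by the gen-7 packager in gate run 26 as `HodgeCM/PerL34/EndStateThm44.lean` (verbatim).
-/
/-
Copyright: pub-hodgecm formalisation cell (harness21, 2026). New file (not vendored).
Origin: HOME/pub-hodgecm-pv01-g5/lean/Pv01g5/EndStateThm44.lean (WIP module `Pv01g5.EndStateThm44`; intended final
place `HodgeCM/PerL34/EndStateThm44.lean` = module `HodgeCM.PerL34.EndStateThm44`, CONTRIBUTING §3) — seat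
planner-pub-hodgecm-pv01-g5-0 (DAG-NODE PROVER #01, gen 5), 2026-08-18.
Nothing is asserted: every statement is proved from the package's definitions and LANDED theorems (no new constants,
no cited fact, no placeholder proof, no `axiom`).
-/
import Summits.HodgeConjecture.HodgeCM.PerL34.CharSpansFinal
import Summits.HodgeConjecture.HodgeCM.PerL34.WAlb
import Summits.HodgeConjecture.HodgeCM.Assembly.CorCM
import Summits.HodgeConjecture.HodgeCM.Proofs.SeesawConstruction_2

/-!
# The PerL end state reaches Theorem 4.4 AS PRINTED (`∀ (V₃,h)`), both realisation inputs, and rfwf Thm 4.1 / `W_RK4`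

The writer-facing END STATE of the PerL side is `AssemblyRoutes.perL_of_openCharsWeilLeavesCRΔ`
(`CharSpansFinal.lean` :151): from the model facts `M`, a theta model `T`, the print leaves `h07 h09a h09b hM38 hAlb`,
the design leaf `h12b`, the five instantiation records `hbr hQ Pc A12 A34`, the realisation input `hch : T.Open_chars`
and the final S1 residual `hW : WeilStepsInputCRΔ T`, it concludes `U.PerL` — the WALL statement `W^L_per`
(`HodgeCM.Universe.PerL`, Statements.lean :51: "… there EXISTS `(V₃,h)` with a nonzero period").

PerL v5's main theorem `thm:main` (Thm 4.4, tex l. 685) is printed — and proved — in the STRONGER form "for EVERY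
hermitian `(V₃,h)` of signature `(2,1)` at `ι₁`, `(3,0)` elsewhere, there is a level `Γ` …", typed verbatim as
`HodgeCM.Universe.PerL44` (Statements.lean :61).  This file records, by one-line calls of LANDED theorems only, that
the SAME binder list proves the printed form and everything the package hangs below the realisation input:

* `inputs_of_leaves`        — the binders give prl1's ten-field record `T.Inputs` (`PerL34.axioms_of_nodes` on the
                              derived node statements N12a/N19w/N19g/N29/N31/N33);
* `realisationExists_of_leaves` — hence BOTH realisation inputs `U.RealisationExistsPerL ∧ U.RealisationExistsFace`
                              (`ThetaModel.realisationExists_of''`, SeesawConstruction.lean :485 — `LevelDirected` and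
                              `Lemma33bLandherr` discharged in-package);
* `perL44_of_openCharsWeilLeavesCRΔ` — **Thm 4.4 as printed** `U.PerL44` (`StubTree.perL44_holds`);
* `perL_of_openCharsWeilLeavesCRΔ'` — the wall form again, now as the specialisation of `PerL44` at Landherr's
                              hermitian space (`Assembly.perL_of_perL44`, `StubTree.landherr_exists` PROVED) — it agrees with the
                              headline;
* `periodThmF_of_…`, `w_rk4_of_…` — rfwf v3 Thm 4.1 over `F` (admissible specialisation, `U.PeriodThmF`) and the
                              Weil-face statement `U.W_RK4` (`Assembly.periodThmF`, `Assembly.w_rk4`);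
* `wLAlb44_of_…`, `wLAlb_of_…` — PerL Lemma 4.2(c) `W^L_Alb` in both quantifier forms (pv04 `WAlb`).
* `endState_conclusions`    — the seven conclusions bundled.

So the distance between the typed end state and the paper's `thm:main` is ZERO binders: the headline of record is the
`∃ V` COROLLARY of what its own hypotheses prove.  (Why the headline was stated as `U.PerL`: it is the conjunct of the
summit statement / the wall `W^L_per` of rfwf; `PerL44 → PerL` needs Landherr's existence theorem, PROVED in
`HodgeCM.Landherr`.)  Binder list, order and types below are those of `perL_of_openCharsWeilLeavesCRΔ` VERBATIM.
-/

set_option autoImplicit false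

noncomputable section

namespace HodgeCM
namespace PerL34
namespace EndStateThm44

open HodgeCM.Prior.Perl34File HodgeCM.Prior.Perl34File.Perl34 HodgeCM.PerL34.ArchC
open HodgeCM.PerL34.AssemblyRoutes

variable {U : Universe}

/-- The T-side binders of the headline give prl1's ten-field theta record `T.Inputs` (the N07 leaf `h07` and the
model facts are not needed for this). -/
theorem inputs_of_leaves (M : U.ModelAxioms) (T : U.ThetaModel)
    (h09a : N09a_embCover T) (h09b : N09b_innerEmb T)
    (hM38 : U.Fact_cmInflation) (hAlb : T.Fact_thetaAlbanese) (h12b : N12b_signRecipe T)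
    (hbr : ∀ {L : CMField} {ι₁ : L →+* ℂ} (V : HermSpace3 L ι₁) (c : SeesawCtx L), T.GoodCtx ι₁ c →
      Nonempty (SeesawDictionary.SeesawBridge T V c (T.t12 V c) 0 1))
    (hQ : ∀ {L : CMField} {ι₁ : L →+* ℂ} (V : HermSpace3 L ι₁) (c : SeesawCtx L), T.GoodCtx ι₁ c →
      Nonempty (QautDictionary.QautBridge T V c (T.t34 V c) 2 3))
    (Pc : ∀ {L : CMField} {ι₁ : L →+* ℂ} (V : HermSpace3 L ι₁) (c : SeesawCtx L),
      C4a.PointedCore (T.core V c))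
    (A12 : ∀ {L : CMField} {ι₁ : L →+* ℂ} (V : HermSpace3 L ι₁) (c : SeesawCtx L),
      T.GoodCtx ι₁ c → Nonempty (ArchCDatum (T.core V c) (T.t12 V c) (Pc V c)))
    (A34 : ∀ {L : CMField} {ι₁ : L →+* ℂ} (V : HermSpace3 L ι₁) (c : SeesawCtx L),
      T.GoodCtx ι₁ c → Nonempty (ArchCDatum (T.core V c) (T.t34 V c) (Pc V c)))
    (hch : T.Open_chars) (hW : CharSpansFinal.WeilStepsInputCRΔ T) : T.Inputs :=
  axioms_of_nodes T h09a h09b (N12a_thetaSub_of_split M T hM38 hAlb) h12b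
    (N19w_wedgeMem_of_bridges_chars T hbr hch) (N19g_genInWedgeSpan_of_bridges T hQ)
    (N29_occ_of_archC T Pc A12 A34) (N31_chars_of_openChars T hch) (N33_wedge_of_CRΔ_chars T hch hW)

/-- **Both realisation inputs** of `U.OpenInputs` from the headline's binder list (`h07` = Hodge–Riemann `(2,0)`
now needed: it makes Prop 4.3's wedge class nonzero in `L²`). -/
theorem realisationExists_of_leaves (M : U.ModelAxioms) (T : U.ThetaModel)
    (h07 : N07_hodgeRiemann20 U) (h09a : N09a_embCover T) (h09b : N09b_innerEmb T)
    (hM38 : U.Fact_cmInflation) (hAlb : T.Fact_thetaAlbanese) (h12b : N12b_signRecipe T)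
    (hbr : ∀ {L : CMField} {ι₁ : L →+* ℂ} (V : HermSpace3 L ι₁) (c : SeesawCtx L), T.GoodCtx ι₁ c →
      Nonempty (SeesawDictionary.SeesawBridge T V c (T.t12 V c) 0 1))
    (hQ : ∀ {L : CMField} {ι₁ : L →+* ℂ} (V : HermSpace3 L ι₁) (c : SeesawCtx L), T.GoodCtx ι₁ c →
      Nonempty (QautDictionary.QautBridge T V c (T.t34 V c) 2 3))
    (Pc : ∀ {L : CMField} {ι₁ : L →+* ℂ} (V : HermSpace3 L ι₁) (c : SeesawCtx L),
      C4a.PointedCore (T.core V c))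
    (A12 : ∀ {L : CMField} {ι₁ : L →+* ℂ} (V : HermSpace3 L ι₁) (c : SeesawCtx L),
      T.GoodCtx ι₁ c → Nonempty (ArchCDatum (T.core V c) (T.t12 V c) (Pc V c)))
    (A34 : ∀ {L : CMField} {ι₁ : L →+* ℂ} (V : HermSpace3 L ι₁) (c : SeesawCtx L),
      T.GoodCtx ι₁ c → Nonempty (ArchCDatum (T.core V c) (T.t34 V c) (Pc V c)))
    (hch : T.Open_chars) (hW : CharSpansFinal.WeilStepsInputCRΔ T) :
    U.RealisationExistsPerL ∧ U.RealisationExistsFace :=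
  T.realisationExists_of'' M (inputs_of_leaves M T h09a h09b hM38 hAlb h12b hbr hQ Pc A12 A34 hch hW) h07

/-- **PerL v5 Theorem 4.4 AS PRINTED** (`thm:main`, tex l. 685: for EVERY `(V₃,h)` there is a level with a nonzero
quadrilinear period) from EXACTLY the binder list of the end state `perL_of_openCharsWeilLeavesCRΔ`. -/
theorem perL44_of_openCharsWeilLeavesCRΔ (M : U.ModelAxioms) (T : U.ThetaModel)
    (h07 : N07_hodgeRiemann20 U) (h09a : N09a_embCover T) (h09b : N09b_innerEmb T)
    (hM38 : U.Fact_cmInflation) (hAlb : T.Fact_thetaAlbanese) (h12b : N12b_signRecipe T)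
    (hbr : ∀ {L : CMField} {ι₁ : L →+* ℂ} (V : HermSpace3 L ι₁) (c : SeesawCtx L), T.GoodCtx ι₁ c →
      Nonempty (SeesawDictionary.SeesawBridge T V c (T.t12 V c) 0 1))
    (hQ : ∀ {L : CMField} {ι₁ : L →+* ℂ} (V : HermSpace3 L ι₁) (c : SeesawCtx L), T.GoodCtx ι₁ c →
      Nonempty (QautDictionary.QautBridge T V c (T.t34 V c) 2 3))
    (Pc : ∀ {L : CMField} {ι₁ : L →+* ℂ} (V : HermSpace3 L ι₁) (c : SeesawCtx L),
      C4a.PointedCore (T.core V c))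
    (A12 : ∀ {L : CMField} {ι₁ : L →+* ℂ} (V : HermSpace3 L ι₁) (c : SeesawCtx L),
      T.GoodCtx ι₁ c → Nonempty (ArchCDatum (T.core V c) (T.t12 V c) (Pc V c)))
    (A34 : ∀ {L : CMField} {ι₁ : L →+* ℂ} (V : HermSpace3 L ι₁) (c : SeesawCtx L),
      T.GoodCtx ι₁ c → Nonempty (ArchCDatum (T.core V c) (T.t34 V c) (Pc V c)))
    (hch : T.Open_chars) (hW : CharSpansFinal.WeilStepsInputCRΔ T) : U.PerL44 :=
  StubTree.perL44_holds U M (realisationExists_of_leaves M T h07 h09a h09b hM38 hAlb h12b hbr hQ Pc A12 A34 hch hW).1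

/-- The wall form `U.PerL` recovered as the `∃ V` corollary of Thm 4.4 as printed (Landherr's existence theorem
`landherr_exists` PROVED); it is the statement of the headline `perL_of_openCharsWeilLeavesCRΔ` (same binders). -/
theorem perL_of_openCharsWeilLeavesCRΔ' (M : U.ModelAxioms) (T : U.ThetaModel)
    (h07 : N07_hodgeRiemann20 U) (h09a : N09a_embCover T) (h09b : N09b_innerEmb T)
    (hM38 : U.Fact_cmInflation) (hAlb : T.Fact_thetaAlbanese) (h12b : N12b_signRecipe T)
    (hbr : ∀ {L : CMField} {ι₁ : L →+* ℂ} (V : HermSpace3 L ι₁) (c : SeesawCtx L), T.GoodCtx ι₁ c →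
      Nonempty (SeesawDictionary.SeesawBridge T V c (T.t12 V c) 0 1))
    (hQ : ∀ {L : CMField} {ι₁ : L →+* ℂ} (V : HermSpace3 L ι₁) (c : SeesawCtx L), T.GoodCtx ι₁ c →
      Nonempty (QautDictionary.QautBridge T V c (T.t34 V c) 2 3))
    (Pc : ∀ {L : CMField} {ι₁ : L →+* ℂ} (V : HermSpace3 L ι₁) (c : SeesawCtx L),
      C4a.PointedCore (T.core V c))
    (A12 : ∀ {L : CMField} {ι₁ : L →+* ℂ} (V : HermSpace3 L ι₁) (c : SeesawCtx L),
      T.GoodCtx ι₁ c → Nonempty (ArchCDatum (T.core V c) (T.t12 V c) (Pc V c)))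
    (A34 : ∀ {L : CMField} {ι₁ : L →+* ℂ} (V : HermSpace3 L ι₁) (c : SeesawCtx L),
      T.GoodCtx ι₁ c → Nonempty (ArchCDatum (T.core V c) (T.t34 V c) (Pc V c)))
    (hch : T.Open_chars) (hW : CharSpansFinal.WeilStepsInputCRΔ T) : U.PerL :=
  Assembly.perL_of_perL44 U StubTree.landherr_exists
    (perL44_of_openCharsWeilLeavesCRΔ M T h07 h09a h09b hM38 hAlb h12b hbr hQ Pc A12 A34 hch hW)

/-- **rfwf v3 Thm 4.1 over `F`** (the admissible specialisation `U.PeriodThmF`, Statements.lean :74) from the PerL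
end state's binders — the face-side realisation input is produced by the same theta model. -/
theorem periodThmF_of_openCharsWeilLeavesCRΔ (M : U.ModelAxioms) (T : U.ThetaModel)
    (h07 : N07_hodgeRiemann20 U) (h09a : N09a_embCover T) (h09b : N09b_innerEmb T)
    (hM38 : U.Fact_cmInflation) (hAlb : T.Fact_thetaAlbanese) (h12b : N12b_signRecipe T)
    (hbr : ∀ {L : CMField} {ι₁ : L →+* ℂ} (V : HermSpace3 L ι₁) (c : SeesawCtx L), T.GoodCtx ι₁ c →
      Nonempty (SeesawDictionary.SeesawBridge T V c (T.t12 V c) 0 1))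
    (hQ : ∀ {L : CMField} {ι₁ : L →+* ℂ} (V : HermSpace3 L ι₁) (c : SeesawCtx L), T.GoodCtx ι₁ c →
      Nonempty (QautDictionary.QautBridge T V c (T.t34 V c) 2 3))
    (Pc : ∀ {L : CMField} {ι₁ : L →+* ℂ} (V : HermSpace3 L ι₁) (c : SeesawCtx L),
      C4a.PointedCore (T.core V c))
    (A12 : ∀ {L : CMField} {ι₁ : L →+* ℂ} (V : HermSpace3 L ι₁) (c : SeesawCtx L),
      T.GoodCtx ι₁ c → Nonempty (ArchCDatum (T.core V c) (T.t12 V c) (Pc V c)))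
    (A34 : ∀ {L : CMField} {ι₁ : L →+* ℂ} (V : HermSpace3 L ι₁) (c : SeesawCtx L),
      T.GoodCtx ι₁ c → Nonempty (ArchCDatum (T.core V c) (T.t34 V c) (Pc V c)))
    (hch : T.Open_chars) (hW : CharSpansFinal.WeilStepsInputCRΔ T) : U.PeriodThmF :=
  Assembly.periodThmF U M
    (realisationExists_of_leaves M T h07 h09a h09b hM38 hAlb h12b hbr hQ Pc A12 A34 hch hW).2

/-- **`W_RK4`** (the rank-four Weil-face classes are algebraic, Statements.lean :95) from the same binders
(`Assembly.w_rk4`: rfwf Thm 4.1 over `F` + the PROVED surface criterion Prop 2.2 + Landherr). -/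
theorem w_rk4_of_openCharsWeilLeavesCRΔ (M : U.ModelAxioms) (T : U.ThetaModel)
    (h07 : N07_hodgeRiemann20 U) (h09a : N09a_embCover T) (h09b : N09b_innerEmb T)
    (hM38 : U.Fact_cmInflation) (hAlb : T.Fact_thetaAlbanese) (h12b : N12b_signRecipe T)
    (hbr : ∀ {L : CMField} {ι₁ : L →+* ℂ} (V : HermSpace3 L ι₁) (c : SeesawCtx L), T.GoodCtx ι₁ c →
      Nonempty (SeesawDictionary.SeesawBridge T V c (T.t12 V c) 0 1))
    (hQ : ∀ {L : CMField} {ι₁ : L →+* ℂ} (V : HermSpace3 L ι₁) (c : SeesawCtx L), T.GoodCtx ι₁ c →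
      Nonempty (QautDictionary.QautBridge T V c (T.t34 V c) 2 3))
    (Pc : ∀ {L : CMField} {ι₁ : L →+* ℂ} (V : HermSpace3 L ι₁) (c : SeesawCtx L),
      C4a.PointedCore (T.core V c))
    (A12 : ∀ {L : CMField} {ι₁ : L →+* ℂ} (V : HermSpace3 L ι₁) (c : SeesawCtx L),
      T.GoodCtx ι₁ c → Nonempty (ArchCDatum (T.core V c) (T.t12 V c) (Pc V c)))
    (A34 : ∀ {L : CMField} {ι₁ : L →+* ℂ} (V : HermSpace3 L ι₁) (c : SeesawCtx L),
      T.GoodCtx ι₁ c → Nonempty (ArchCDatum (T.core V c) (T.t34 V c) (Pc V c)))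
    (hch : T.Open_chars) (hW : CharSpansFinal.WeilStepsInputCRΔ T) : U.W_RK4 :=
  Assembly.w_rk4 U M
    (realisationExists_of_leaves M T h07 h09a h09b hM38 hAlb h12b hbr hQ Pc A12 A34 hch hW).2

/-- **PerL Lemma 4.2(c) `W^L_Alb`, "every `(V₃,h)`" form** (pv04 `WAlb.WLAlb44`) from the end state. -/
theorem wLAlb44_of_openCharsWeilLeavesCRΔ (M : U.ModelAxioms) (T : U.ThetaModel)
    (h07 : N07_hodgeRiemann20 U) (h09a : N09a_embCover T) (h09b : N09b_innerEmb T)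
    (hM38 : U.Fact_cmInflation) (hAlb : T.Fact_thetaAlbanese) (h12b : N12b_signRecipe T)
    (hbr : ∀ {L : CMField} {ι₁ : L →+* ℂ} (V : HermSpace3 L ι₁) (c : SeesawCtx L), T.GoodCtx ι₁ c →
      Nonempty (SeesawDictionary.SeesawBridge T V c (T.t12 V c) 0 1))
    (hQ : ∀ {L : CMField} {ι₁ : L →+* ℂ} (V : HermSpace3 L ι₁) (c : SeesawCtx L), T.GoodCtx ι₁ c →
      Nonempty (QautDictionary.QautBridge T V c (T.t34 V c) 2 3))
    (Pc : ∀ {L : CMField} {ι₁ : L →+* ℂ} (V : HermSpace3 L ι₁) (c : SeesawCtx L),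
      C4a.PointedCore (T.core V c))
    (A12 : ∀ {L : CMField} {ι₁ : L →+* ℂ} (V : HermSpace3 L ι₁) (c : SeesawCtx L),
      T.GoodCtx ι₁ c → Nonempty (ArchCDatum (T.core V c) (T.t12 V c) (Pc V c)))
    (A34 : ∀ {L : CMField} {ι₁ : L →+* ℂ} (V : HermSpace3 L ι₁) (c : SeesawCtx L),
      T.GoodCtx ι₁ c → Nonempty (ArchCDatum (T.core V c) (T.t34 V c) (Pc V c)))
    (hch : T.Open_chars) (hW : CharSpansFinal.WeilStepsInputCRΔ T) : WAlb.WLAlb44 U :=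
  WAlb.wLAlb44_of_perL44 (U := U)
    (perL44_of_openCharsWeilLeavesCRΔ M T h07 h09a h09b hM38 hAlb h12b hbr hQ Pc A12 A34 hch hW)

/-- **The seven conclusions of the PerL end state at once**: Thm 4.4 as printed, the wall `W^L_per`, both realisation
inputs, rfwf Thm 4.1 over `F`, `W_RK4`, and `W^L_Alb` (every `(V₃,h)`). -/
theorem endState_conclusions (M : U.ModelAxioms) (T : U.ThetaModel)
    (h07 : N07_hodgeRiemann20 U) (h09a : N09a_embCover T) (h09b : N09b_innerEmb T)
    (hM38 : U.Fact_cmInflation) (hAlb : T.Fact_thetaAlbanese) (h12b : N12b_signRecipe T)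
    (hbr : ∀ {L : CMField} {ι₁ : L →+* ℂ} (V : HermSpace3 L ι₁) (c : SeesawCtx L), T.GoodCtx ι₁ c →
      Nonempty (SeesawDictionary.SeesawBridge T V c (T.t12 V c) 0 1))
    (hQ : ∀ {L : CMField} {ι₁ : L →+* ℂ} (V : HermSpace3 L ι₁) (c : SeesawCtx L), T.GoodCtx ι₁ c →
      Nonempty (QautDictionary.QautBridge T V c (T.t34 V c) 2 3))
    (Pc : ∀ {L : CMField} {ι₁ : L →+* ℂ} (V : HermSpace3 L ι₁) (c : SeesawCtx L),
      C4a.PointedCore (T.core V c))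
    (A12 : ∀ {L : CMField} {ι₁ : L →+* ℂ} (V : HermSpace3 L ι₁) (c : SeesawCtx L),
      T.GoodCtx ι₁ c → Nonempty (ArchCDatum (T.core V c) (T.t12 V c) (Pc V c)))
    (A34 : ∀ {L : CMField} {ι₁ : L →+* ℂ} (V : HermSpace3 L ι₁) (c : SeesawCtx L),
      T.GoodCtx ι₁ c → Nonempty (ArchCDatum (T.core V c) (T.t34 V c) (Pc V c)))
    (hch : T.Open_chars) (hW : CharSpansFinal.WeilStepsInputCRΔ T) :
    U.PerL44 ∧ U.PerL ∧ (U.RealisationExistsPerL ∧ U.RealisationExistsFace) ∧ U.PeriodThmF ∧ U.W_RK4 ∧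
      WAlb.WLAlb44 U ∧ WAlb.WLAlb U := by
  have hR := realisationExists_of_leaves M T h07 h09a h09b hM38 hAlb h12b hbr hQ Pc A12 A34 hch hW
  have h44 := StubTree.perL44_holds U M hR.1
  have hP := Assembly.perL U M hR.1
  exact ⟨h44, hP, hR, Assembly.periodThmF U M hR.2, Assembly.w_rk4 U M hR.2,
    WAlb.wLAlb44_of_perL44 (U := U) h44, WAlb.wLAlb_of_perL (U := U) hP⟩

/-- Sanity: the headline of record is literally recovered (proof-irrelevant agreement of the two routes to `U.PerL`). -/
example (M : U.ModelAxioms) (T : U.ThetaModel)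
    (h07 : N07_hodgeRiemann20 U) (h09a : N09a_embCover T) (h09b : N09b_innerEmb T)
    (hM38 : U.Fact_cmInflation) (hAlb : T.Fact_thetaAlbanese) (h12b : N12b_signRecipe T)
    (hbr : ∀ {L : CMField} {ι₁ : L →+* ℂ} (V : HermSpace3 L ι₁) (c : SeesawCtx L), T.GoodCtx ι₁ c →
      Nonempty (SeesawDictionary.SeesawBridge T V c (T.t12 V c) 0 1))
    (hQ : ∀ {L : CMField} {ι₁ : L →+* ℂ} (V : HermSpace3 L ι₁) (c : SeesawCtx L), T.GoodCtx ι₁ c →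
      Nonempty (QautDictionary.QautBridge T V c (T.t34 V c) 2 3))
    (Pc : ∀ {L : CMField} {ι₁ : L →+* ℂ} (V : HermSpace3 L ι₁) (c : SeesawCtx L),
      C4a.PointedCore (T.core V c))
    (A12 : ∀ {L : CMField} {ι₁ : L →+* ℂ} (V : HermSpace3 L ι₁) (c : SeesawCtx L),
      T.GoodCtx ι₁ c → Nonempty (ArchCDatum (T.core V c) (T.t12 V c) (Pc V c)))
    (A34 : ∀ {L : CMField} {ι₁ : L →+* ℂ} (V : HermSpace3 L ι₁) (c : SeesawCtx L),
      T.GoodCtx ι₁ c → Nonempty (ArchCDatum (T.core V c) (T.t34 V c) (Pc V c)))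
    (hch : T.Open_chars) (hW : CharSpansFinal.WeilStepsInputCRΔ T) :
    perL_of_openCharsWeilLeavesCRΔ M T h07 h09a h09b hM38 hAlb h12b hbr hQ Pc A12 A34 hch hW =
      perL_of_openCharsWeilLeavesCRΔ' M T h07 h09a h09b hM38 hAlb h12b hbr hQ Pc A12 A34 hch hW := rfl

end EndStateThm44
end PerL34
end HodgeCM
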